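import Summits.NavierStokesRegularity.FluidComputer.HeadStartBeable

/-!
# Tao's delay gate from a CLOCK HEAD-START, part 8 (additive): the sharp critical time of a clock BEHIND

Companion file of `HeadStart{Transition,Quiet,Sub,Window,Fire,Douse,Beable}.lean` (cell `pub-fluidc`,
blueprint seat bp1; namespace `Summit.NavierStokesRegularity.FluidComputer.HeadStart`). HONEST FRAMING
(verbatim): low prior, high value-of-information experiment on Tao's machine paradigm; NOT a claim that NS
blows up. Everything here concerns the five-mode truncation (5.5) of [Tao2016AveragedNS, §5.5] in the
retuned form `delayCircuitWith K M ε` with the diagonal damping `-E(t) * X`, `0 ≤ Eᵢ(t) ≤ η`, on `[0,2]`,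
started in the signed head-start class `HS±(ε)` of part 1 with the clock BEHIND (`b₀ ≤ 0`,
`h = b₀/ε ∈ [-1/5, 0]`); nothing is proved about the Navier–Stokes equations.

Part 7 (`HeadStart.firingPhase`) locates the critical time of a clock behind only up to an extra `h²`:
part 3's sub-solution is seeded at `t = 0`, where the trigger's sweep rate `≈ M(t + h)` is still NEGATIVE,
while the seed that decides the transition is laid when the clock passes zero (`t ≈ |h|`). This file
re-seeds there: `c_lower_delay` (`(1-θ)εs₁ = -b₀`, `θ = 17K⁻²⁰ + 9η`: `c(t) ≥ (ε²/(12K¹⁰))·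
exp((1-θ)M(t-s₁)²/2 - 2η - M)` on `[s₁ + 1/(2(K⁵+M)), τ]` — part 3's two stages run from `s₁`, the
integrating factor used near its maximum = the completed square); `tc_delay` (`b₀ ≤ 0`:
`|t_c - (√2 + |h|)| ≤ 12 log K/M + 15η` — lower edge from part 4's square-completed bound
`(t_c + h)² ≥ 2 - 24 log K/M - 27η`, upper edge from `c_lower_delay` at `t_c`);
`HeadStart.firingPhase_delay` (+ `_explicit`) — THE GATE THEOREM FOR A CLOCK BEHIND with the sharp time
`|t_c - (√2 - b₀/ε)| ≤ 12 log K/M + 15η` and part 7's (able)/(beable) boxes. With part 7 (sharp for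
`b₀ ≥ 0`: `t_c ≈ √(2+h²) - h`) a mis-charged clock is pinned on BOTH sides up to `O(log K/M + η)`: ahead by
`hε` ⇒ EARLIER by `h - (√(2+h²) - √2) ≤ h`; behind by `|h|ε` ⇒ LATER by exactly `|h|` (1-Lipschitz, kink at 0).

[cite: Tao2016AveragedNS, §5.5 Thm 5.3, proof of (tcable) pp. 28–30]
-/

noncomputable section

namespace Summit.NavierStokesRegularity.FluidComputer

open Real Set Filter Topology
open Literature.Analysis.FluidPDE.Tao2016AveragedNS
open Literature.Analysis.FluidPDE.Tao2016AveragedNS.Thm53 (monotoneOn_intFactor invSqrt_facts sqrt_two_gt)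
open Literature.Analysis.FluidPDE.Tao2016AveragedNS.Thm53With (log_facts family_params eps_facts)
open DampedTransition (hasDerivAt_c family_params_damped)

namespace HeadStart

section Delay

variable {K M ε η τ : ℝ} {E X : ℝ → Fin 5 → ℝ}

set_option maxHeartbeats 400000 in
/-- Sub-solution for `c` re-seeded at the clock's zero: for `s₁ ≥ 0` with `(1-θ)ε s₁ = -b₀` (`θ = 17K⁻²⁰ + 9η`,
`η ≤ 1/10`; `c ≤ K⁻¹⁰ε²` on `[0,τ]`), `c(t) ≥ (ε²/(12K¹⁰)) exp((1-θ)M(t-s₁)²/2 - 2η - M)` on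
`[s₁ + 1/(2(K⁵+M)), τ]`: part 3's bracket and integrating factor `G(s) = ks²/2 + (ν₀ - η)s` (`k = (1-θ)M`,
`ν₀ = ε⁻¹Mb₀ = -ks₁`), first stage on `[s₁, s₁ + 1/(2(K⁵+M))]` where `-G(s) ≥ ks₁²/2 - 1/8`, then
monotonicity of `c e^{-G}`; `ks₁²/2 + G(t) = k(t-s₁)²/2 - ηt`. [cite: Tao2016AveragedNS, §5.5 (tcable)] -/
theorem c_lower_delay
    (hX : ∀ t ∈ Icc (0:ℝ) 2, HasDerivAt X (delayCircuitWith K M ε (X t) - E t * X t) t)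
    (hE : ∀ t ∈ Icc (0:ℝ) 2, ∀ i, 0 ≤ E t i ∧ E t i ≤ η)
    (h0 : X 0 0 ^ 2 + X 0 1 ^ 2 = 1 ∧ 0 ≤ X 0 0 ∧ -(1 / 5 * ε) ≤ X 0 1 ∧ X 0 1 ≤ 2 / 5 * ε ∧ X 0 2 = 0 ∧ X 0 3 = 0 ∧ X 0 4 = 0)
    (hε : 0 < ε) (hε1 : ε ≤ 1) (hM0 : 0 < M) (hMK : M ≤ K ^ 10) (hK : 2 ≤ K) (hη : η ≤ 1 / 10)
    (hτ2 : τ ≤ 2) (hεK : ε ^ 2 ≤ 1 / (12 * K ^ 20))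
    (hcτ : ∀ t, 0 ≤ t → t ≤ τ → X t 2 ≤ ε ^ 2 / K ^ 10)
    {s₁ : ℝ} (hs₁0 : 0 ≤ s₁) (hs₁ : (1 - (17 / K ^ 20 + 9 * η)) * ε * s₁ = -X 0 1)
    {t : ℝ} (ht : t ∈ Icc (s₁ + 1 / (2 * (K ^ 5 + M))) τ) :
    ε ^ 2 / (12 * K ^ 10) *
      exp ((1 - (17 / K ^ 20 + 9 * η)) * M * (t - s₁) ^ 2 / 2 - 2 * η - M) ≤ X t 2 := by
  obtain ⟨hK0, hK1, hεne⟩ : 0 < K ∧ 1 ≤ K ∧ ε ≠ 0 := ⟨by linarith, by linarith, hε.ne'⟩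
  have hη0 : 0 ≤ η := (hE 0 ⟨le_rfl, zero_le_two⟩ 0).1.trans (hE 0 ⟨le_rfl, zero_le_two⟩ 0).2
  have hK20 : (2 : ℝ) ^ 20 ≤ K ^ 20 := pow_le_pow_left₀ (by norm_num) hK 20
  set θ : ℝ := 17 / K ^ 20 + 9 * η with hθ
  have hθ0 : 0 ≤ θ := by positivity
  have h17 : 17 / K ^ 20 ≤ 1 / 10 := by
    rw [div_le_div_iff₀ (by positivity) (by norm_num)]; norm_num at hK20 ⊢; linarith
  have hθ1 : θ ≤ 1 := by simp only [hθ]; linarith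
  set k : ℝ := (1 - θ) * M with hk
  have hk0 : 0 ≤ k := mul_nonneg (by linarith) hM0.le
  have hkM : k ≤ M := by
    have : (1 - θ) * M ≤ 1 * M := mul_le_mul_of_nonneg_right (by linarith) hM0.le; linarith
  -- the pre-load's sweep rate `ν₀ = ε⁻¹ M b₀ = -k s₁`
  set ν₀ : ℝ := ε⁻¹ * M * X 0 1 with hν₀
  have hν : ν₀ = -(k * s₁) := by
    have e : ν₀ = -(ε⁻¹ * M * ((1 - θ) * ε * s₁)) := by simp only [hν₀]; rw [hs₁]; ring
    rw [e, hk]; field_simp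
  set μ : ℝ := ε ^ 2 * exp (-M) with hμ
  set R : ℝ := K ^ 5 + M with hR
  have hR0 : 0 < R := by positivity
  set s₀ : ℝ := 1 / (2 * R) with hs₀
  have hs₀0 : 0 < s₀ := by positivity
  -- `k s₀² ≤ 1/4` (from `M ≤ K¹⁰ ≤ R²`)
  have hMR : M ≤ R * R := by
    have h5 : K ^ 5 ≤ R := by simp only [hR]; linarith
    exact hMK.trans (by rw [show K ^ 10 = K ^ 5 * K ^ 5 by ring]; exact mul_le_mul h5 h5 (by positivity) hR0.le)
  have hks₀ : k * (s₀ * s₀) ≤ 1 / 4 := by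
    calc k * (s₀ * s₀) ≤ M * (s₀ * s₀) := mul_le_mul_of_nonneg_right hkM (mul_self_nonneg _)
      _ ≤ R * R * (s₀ * s₀) := mul_le_mul_of_nonneg_right hMR (mul_self_nonneg _)
      _ = 1 / 4 := by simp only [hs₀]; field_simp; ring
  have hs₁τ : s₁ + s₀ ≤ τ := ht.1.trans ht.2
  -- integrating factor `G(s) = k s²/2 + (ν₀ - η) s`
  have hG : ∀ s, HasDerivAt (fun r : ℝ => k / 2 * (r * r) + (ν₀ - η) * r) (k * s + (ν₀ - η)) s := by
    intro s
    exact ((((hasDerivAt_id s).mul (hasDerivAt_id s)).const_mul (k / 2)).add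
      ((hasDerivAt_id s).const_mul (ν₀ - η))).congr_deriv (by simp; ring)
  -- the bracket `(c' - (ks + ν₀ - η)c) e^{-G} ≥ (μ/2) e^{-G}` on `[0,τ]` (verbatim from part 3)
  have hbr : ∀ s ∈ Icc 0 τ, μ / 2 * exp (-(k / 2 * (s * s) + (ν₀ - η) * s)) ≤
      (ε ^ 2 * exp (-M) * X s 0 ^ 2 + ε⁻¹ * M * X s 1 * X s 2 - E s 2 * X s 2
        - (k * s + (ν₀ - η)) * X s 2) * exp (-(k / 2 * (s * s) + (ν₀ - η) * s)) := by
    intro s hs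
    have hs2 : s ∈ Icc (0 : ℝ) 2 := ⟨hs.1, hs.2.trans hτ2⟩
    have hc0 : 0 ≤ X s 2 := c_nonneg hX hE h0 hε hε1 hM0.le hs2
    have ha1 : |X s 0 - 1| ≤ 8 / K ^ 20 + 2 * η := a_window hX hE h0 hε hε1 hM0.le hK0 hτ2 hεK hcτ hs
    have hb : |X s 1 - (X 0 1 + ε * s)| ≤ (17 / K ^ 20 + 9 * η) * ε * s :=
      b_window hX hE h0 hε hε1 hM0 hMK hK1 hτ2 hεK hcτ hs
    have h8 : 8 / K ^ 20 ≤ 1 / 40 := by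
      rw [div_le_div_iff₀ (by positivity) (by norm_num)]; norm_num at hK20 ⊢; linarith
    have ha_lo : 3 / 4 ≤ X s 0 := by have := (abs_le.1 ha1).1; linarith
    have ha2 : 1 / 2 ≤ X s 0 ^ 2 := by nlinarith
    have hνb : k * s + ν₀ ≤ ε⁻¹ * M * X s 1 := by
      have hb' : X 0 1 + ε * s - θ * ε * s ≤ X s 1 := by have := (abs_le.1 hb).1; simp only [hθ]; linarith
      calc k * s + ν₀ = ε⁻¹ * M * (X 0 1 + ε * s - θ * ε * s) := by
            simp only [hk, hν₀]; field_simp; ring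
        _ ≤ ε⁻¹ * M * X s 1 := mul_le_mul_of_nonneg_left hb' (by have := hM0.le; positivity)
    have h1 : μ / 2 ≤ ε ^ 2 * exp (-M) * X s 0 ^ 2 := by
      have : ε ^ 2 * exp (-M) * (1 / 2) ≤ ε ^ 2 * exp (-M) * X s 0 ^ 2 :=
        mul_le_mul_of_nonneg_left ha2 (by positivity)
      simp only [hμ] at this ⊢; linarith
    have h2 : (k * s + ν₀) * X s 2 ≤ ε⁻¹ * M * X s 1 * X s 2 := mul_le_mul_of_nonneg_right hνb hc0
    have h3 : E s 2 * X s 2 ≤ η * X s 2 := mul_le_mul_of_nonneg_right (hE s hs2 2).2 hc0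
    have hbr' : μ / 2 ≤ ε ^ 2 * exp (-M) * X s 0 ^ 2 + ε⁻¹ * M * X s 1 * X s 2 - E s 2 * X s 2
        - (k * s + (ν₀ - η)) * X s 2 := by
      have e : (k * s + (ν₀ - η)) * X s 2 = (k * s + ν₀) * X s 2 - η * X s 2 := by ring
      linarith
    exact mul_le_mul_of_nonneg_right hbr' (exp_pos _).le
  -- Stage A: on `[s₁, s₁ + s₀]`, `e^{-G} ≥ (2/3) e^{k s₁²/2}`, so `c e^{-G} - (μ/3) e^{k s₁²/2} s` is monotone
  have h78 : (7:ℝ) / 8 ≤ exp (-(1 / 8 : ℝ)) := by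
    have := Real.add_one_le_exp (-(1 / 8 : ℝ)); norm_num at this ⊢; linarith
  have hmonoA := monotoneOn_intFactor (s := Icc s₁ (s₁ + s₀)) (g := fun s => k * s + (ν₀ - η))
    (G := fun r => k / 2 * (r * r) + (ν₀ - η) * r) (φ := fun _ => μ / 3 * exp (k / 2 * (s₁ * s₁)))
    (Φ := fun s => μ / 3 * exp (k / 2 * (s₁ * s₁)) * s) (convex_Icc s₁ (s₁ + s₀))
    (fun s hs => hasDerivAt_c (hX s ⟨hs₁0.trans hs.1, hs.2.trans (hs₁τ.trans hτ2)⟩))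
    (fun s _ => hG s)
    (fun s _ => ((hasDerivAt_id s).const_mul (μ / 3 * exp (k / 2 * (s₁ * s₁)))).congr_deriv (by simp))
    (fun s hs => by
      have hexp : 2 / 3 * exp (k / 2 * (s₁ * s₁)) ≤ exp (-(k / 2 * (s * s) + (ν₀ - η) * s)) := by
        have hss : k * ((s - s₁) * (s - s₁)) ≤ 1 / 4 :=
          (mul_le_mul_of_nonneg_left
            (mul_self_le_mul_self (by linarith [hs.1]) (by linarith [hs.2])) hk0).trans hks₀
        have hηs : 0 ≤ η * s := mul_nonneg hη0 (hs₁0.trans hs.1)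
        have harg : k / 2 * (s₁ * s₁) + -(1 / 8 : ℝ) ≤ -(k / 2 * (s * s) + (ν₀ - η) * s) := by
          have e : -(k / 2 * (s * s) + (ν₀ - η) * s)
              = k / 2 * (s₁ * s₁) - k * ((s - s₁) * (s - s₁)) / 2 + η * s := by rw [hν]; ring
          rw [e]; linarith
        have hp := exp_pos (k / 2 * (s₁ * s₁))
        calc 2 / 3 * exp (k / 2 * (s₁ * s₁)) ≤ exp (k / 2 * (s₁ * s₁)) * (7 / 8) := by linarith
          _ ≤ exp (k / 2 * (s₁ * s₁)) * exp (-(1 / 8 : ℝ)) := mul_le_mul_of_nonneg_left h78 hp.le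
          _ = exp (k / 2 * (s₁ * s₁) + -(1 / 8 : ℝ)) := (exp_add _ _).symm
          _ ≤ exp (-(k / 2 * (s * s) + (ν₀ - η) * s)) := exp_le_exp.2 harg
      calc μ / 3 * exp (k / 2 * (s₁ * s₁)) = μ / 2 * (2 / 3 * exp (k / 2 * (s₁ * s₁))) := by ring
        _ ≤ μ / 2 * exp (-(k / 2 * (s * s) + (ν₀ - η) * s)) :=
            mul_le_mul_of_nonneg_left hexp (by positivity)
        _ ≤ _ := hbr s ⟨hs₁0.trans hs.1, hs.2.trans hs₁τ⟩)
  have hA := hmonoA (⟨le_rfl, by linarith⟩ : s₁ ∈ Icc s₁ (s₁ + s₀)) ⟨by linarith, le_rfl⟩ (by linarith)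
  dsimp only at hA
  have hc1 : 0 ≤ X s₁ 2 * exp (-(k / 2 * (s₁ * s₁) + (ν₀ - η) * s₁)) :=
    mul_nonneg (c_nonneg hX hE h0 hε hε1 hM0.le ⟨hs₁0, by linarith⟩) (exp_pos _).le
  -- Stage B: on `[s₁ + s₀, τ]`, `c e^{-G}` is monotone
  have hmonoB := monotoneOn_intFactor (s := Icc (s₁ + s₀) τ) (g := fun s => k * s + (ν₀ - η))
    (G := fun r => k / 2 * (r * r) + (ν₀ - η) * r) (φ := fun _ => 0) (Φ := fun _ => 0)
    (convex_Icc (s₁ + s₀) τ)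
    (fun s hs => hasDerivAt_c (hX s ⟨by linarith [hs.1, hs₀0.le], hs.2.trans hτ2⟩))
    (fun s _ => hG s) (fun s _ => hasDerivAt_const s (0 : ℝ))
    (fun s hs => le_trans (by positivity) (hbr s ⟨by linarith [hs.1, hs₀0.le], hs.2⟩))
  have hB := hmonoB (⟨le_rfl, hs₁τ⟩ : s₁ + s₀ ∈ Icc (s₁ + s₀) τ) ht ht.1
  simp only [sub_zero] at hB
  -- combine: `c t e^{-G t} ≥ (μ/3) e^{k s₁²/2} s₀`
  have hct : μ / 3 * exp (k / 2 * (s₁ * s₁)) * s₀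
      ≤ X t 2 * exp (-(k / 2 * (t * t) + (ν₀ - η) * t)) := by linarith [hA, hB, hc1]
  have hE' : X t 2 = X t 2 * exp (-(k / 2 * (t * t) + (ν₀ - η) * t))
      * exp (k / 2 * (t * t) + (ν₀ - η) * t) := by
    rw [mul_assoc, ← exp_add, neg_add_cancel, exp_zero, mul_one]
  -- `(μ/3) s₀ = ε² e^{-M}/(6R) ≥ ε² e^{-M}/(12 K¹⁰)`
  have hR2 : R ≤ 2 * K ^ 10 := by
    have h5 : K ^ 5 ≤ K ^ 10 := pow_le_pow_right₀ hK1 (by norm_num); simp only [hR]; linarith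
  have hpref : ε ^ 2 / (12 * K ^ 10) * exp (-M) ≤ μ / 3 * s₀ := by
    have e : μ / 3 * s₀ = ε ^ 2 * exp (-M) / (6 * R) := by simp only [hμ, hs₀]; field_simp; ring
    rw [e, div_mul_eq_mul_div, div_le_div_iff₀ (by positivity) (by positivity)]
    exact mul_le_mul_of_nonneg_left (by linarith) (by positivity)
  rw [hE']
  calc ε ^ 2 / (12 * K ^ 10) * exp ((1 - (17 / K ^ 20 + 9 * η)) * M * (t - s₁) ^ 2 / 2 - 2 * η - M)
      = ε ^ 2 / (12 * K ^ 10) * exp (-M) * exp (k / 2 * ((t - s₁) * (t - s₁)) - 2 * η) := by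
        simp only [hk, hθ]
        rw [show (1 - (17 / K ^ 20 + 9 * η)) * M * (t - s₁) ^ 2 / 2 - 2 * η - M
            = -M + ((1 - (17 / K ^ 20 + 9 * η)) * M / 2 * ((t - s₁) * (t - s₁)) - 2 * η) by ring,
          exp_add (-M)]
        ring
    _ ≤ μ / 3 * s₀ * exp (k / 2 * ((t - s₁) * (t - s₁)) - 2 * η) :=
        mul_le_mul_of_nonneg_right hpref (exp_pos _).le
    _ ≤ μ / 3 * s₀ * exp (k / 2 * (s₁ * s₁) + (k / 2 * (t * t) + (ν₀ - η) * t)) := by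
        have hηt : η * t ≤ η * 2 := mul_le_mul_of_nonneg_left (ht.2.trans hτ2) hη0
        refine mul_le_mul_of_nonneg_left (exp_le_exp.2 ?_) (by positivity)
        have e : k / 2 * (s₁ * s₁) + (k / 2 * (t * t) + (ν₀ - η) * t)
            = k / 2 * ((t - s₁) * (t - s₁)) - η * t := by rw [hν]; ring
        rw [e]; linarith
    _ = μ / 3 * exp (k / 2 * (s₁ * s₁)) * s₀ * exp (k / 2 * (t * t) + (ν₀ - η) * t) := by
        rw [exp_add]; ring
    _ ≤ X t 2 * exp (-(k / 2 * (t * t) + (ν₀ - η) * t)) * exp (k / 2 * (t * t) + (ν₀ - η) * t) :=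
        mul_le_mul_of_nonneg_right hct (exp_pos _).le

/-- `u² ≤ 2 + y` (`y ≥ 0`) gives `u ≤ √2 + y/2`. -/
theorem le_sqrt_two_add {u y : ℝ} (hy : 0 ≤ y) (h : u ^ 2 ≤ 2 + y) : u ≤ sqrt 2 + y / 2 := by
  by_contra hlt
  have hs : sqrt 2 * sqrt 2 = 2 := Real.mul_self_sqrt (by norm_num)
  have h72 := sqrt_two_gt
  have hm := mul_self_lt_mul_self (by positivity) (not_le.1 hlt)
  nlinarith

/-- `2 - x ≤ v²` (`v ≥ 0`, `0 ≤ x ≤ 8/5`) gives `√2 - x/2 ≤ v`. -/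
theorem sqrt_two_sub_le {v x : ℝ} (hv : 0 ≤ v) (hx0 : 0 ≤ x) (hx : x ≤ 8 / 5) (h : 2 - x ≤ v ^ 2) :
    sqrt 2 - x / 2 ≤ v := by
  by_contra hlt
  have hs : sqrt 2 * sqrt 2 = 2 := Real.mul_self_sqrt (by norm_num)
  have h72 := sqrt_two_gt
  have hm := mul_self_lt_mul_self hv (not_le.1 hlt)
  nlinarith

set_option maxHeartbeats 400000 in
/-- **The sharp critical time of a clock BEHIND (`b₀ ≤ 0`, `h = b₀/ε ∈ [-1/5, 0]`), damping `η ≤ 1/1000`.**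
At part 4's hitting time `τ` (`1 ≤ τ ≤ 2`, `c ≤ K⁻¹⁰ε²` on `[0,τ]`, `c(τ) = K⁻¹⁰ε²`,
`2 - 24 log K/M - 27η - h² ≤ τ² + 2hτ`): `|τ - (√2 + |h|)| ≤ 12 log K/M + 15η` (lower edge:
`(τ + h)² ≥ 2 - 24 log K/M - 27η`; upper edge: `c_lower_delay` at `τ` gives `(1-θ)M(τ-s₁)²/2 - 2η - M ≤
log 12 < 3`, so `(τ-s₁)² ≤ 2 + 7/M + (41/20)θ`, and `s₁ = |h| + θs₁`). [cite: Tao2016AveragedNS, §5.5] -/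
theorem tc_delay
    (hX : ∀ t ∈ Icc (0:ℝ) 2, HasDerivAt X (delayCircuitWith K M ε (X t) - E t * X t) t)
    (hE : ∀ t ∈ Icc (0:ℝ) 2, ∀ i, 0 ≤ E t i ∧ E t i ≤ η)
    (h0 : X 0 0 ^ 2 + X 0 1 ^ 2 = 1 ∧ 0 ≤ X 0 0 ∧ -(1 / 5 * ε) ≤ X 0 1 ∧ X 0 1 ≤ 2 / 5 * ε ∧ X 0 2 = 0 ∧ X 0 3 = 0 ∧ X 0 4 = 0)
    (hε : 0 < ε) (hε1 : ε ≤ 1) (hM0 : 0 < M) (hMK : M ≤ K ^ 10) (hK : 16 ≤ K)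
    (hML : 1250 * Real.log K ≤ M) (hεK : ε ^ 2 ≤ 1 / (12 * K ^ 20)) (hη : η ≤ 1 / 1000)
    (hb0 : X 0 1 ≤ 0) (hτ1 : 1 ≤ τ) (hτ2 : τ ≤ 2)
    (hcτ : ∀ t, 0 ≤ t → t ≤ τ → X t 2 ≤ ε ^ 2 / K ^ 10) (hcτeq : X τ 2 = ε ^ 2 / K ^ 10)
    (hlo : 2 - 24 * Real.log K / M - 27 * η - (max (-(X 0 1 / ε)) 0) ^ 2 ≤ τ ^ 2 + 2 * (X 0 1 / ε) * τ) :
    |τ - (sqrt 2 - X 0 1 / ε)| ≤ 12 * Real.log K / M + 15 * η := by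
  obtain ⟨hK2, hK0, hεne, hMne⟩ : 2 ≤ K ∧ 0 < K ∧ ε ≠ 0 ∧ M ≠ 0 := ⟨by linarith, by linarith, hε.ne', hM0.ne'⟩
  have hη0 : 0 ≤ η := (hE 0 ⟨le_rfl, zero_le_two⟩ 0).1.trans (hE 0 ⟨le_rfl, zero_le_two⟩ 0).2
  have hη10 : η ≤ 1 / 10 := by linarith
  obtain ⟨hlog, -, hlog0⟩ := log_facts hK
  have hM2500 : 2500 ≤ M := by linarith
  have hK10 : (16 : ℝ) ^ 10 ≤ K ^ 10 := pow_le_pow_left₀ (by norm_num) hK 10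
  have hK10p : 0 < K ^ 10 := by positivity
  have hK20 : K ^ 20 = K ^ 10 * K ^ 10 := by ring
  have hK20ge : (16 : ℝ) ^ 10 * 16 ^ 10 ≤ K ^ 10 * K ^ 10 :=
    mul_le_mul hK10 hK10 (by positivity) (by positivity)
  obtain ⟨θ, hθ⟩ : ∃ θ : ℝ, θ = 17 / K ^ 20 + 9 * η := ⟨_, rfl⟩
  have hθ0 : 0 ≤ θ := by rw [hθ]; positivity
  have h17 : 17 / K ^ 20 ≤ 1 / 1100 := by
    rw [div_le_div_iff₀ (by positivity) (by norm_num), hK20]; norm_num at hK20ge ⊢; linarith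
  have hθ100 : θ ≤ 1 / 100 := by rw [hθ]; linarith
  -- the head-start `hh = b₀/ε ∈ [-1/5, 0]` and the re-seeding time `s₁ = |hh|/(1-θ) ≤ 1/4`
  set hh : ℝ := X 0 1 / ε with hhh
  have hh5 : -(1 / 5) ≤ hh := by rw [hhh, le_div_iff₀ hε]; linarith [h0.2.2.1]
  have hh0 : hh ≤ 0 := by rw [hhh, div_le_iff₀ hε]; simpa using hb0
  have h1θ : 0 < 1 - θ := by linarith
  have h1θne : 1 - θ ≠ 0 := h1θ.ne'
  obtain ⟨s₁, hs₁def⟩ : ∃ s₁ : ℝ, s₁ = -hh / (1 - θ) := ⟨_, rfl⟩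
  have hs₁0 : 0 ≤ s₁ := by rw [hs₁def]; exact div_nonneg (by linarith) h1θ.le
  have hθs₁ : (1 - θ) * s₁ = -hh := by rw [hs₁def]; field_simp
  have hs₁ : (1 - (17 / K ^ 20 + 9 * η)) * ε * s₁ = -X 0 1 := by
    rw [← hθ, show (1 - θ) * ε * s₁ = ε * ((1 - θ) * s₁) by ring, hθs₁, hhh]; field_simp
  have hθs₁' : θ * s₁ ≤ 1 / 100 * s₁ := mul_le_mul_of_nonneg_right hθ100 hs₁0
  have hs₁4 : s₁ ≤ 1 / 4 := by linarith
  -- upper edge: `c_lower_delay` at `τ`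
  have hs₀ : 1 / (2 * (K ^ 5 + M)) ≤ 1 / 2 := by
    rw [div_le_div_iff₀ (by positivity) (by norm_num)]; have := pow_pos hK0 5; linarith
  have hlow := c_lower_delay hX hE h0 hε hε1 hM0 hMK hK2 hη10 hτ2 hεK hcτ hs₁0 hs₁ (t := τ)
    ⟨by linarith, le_rfl⟩
  rw [← hθ, hcτeq] at hlow
  set u : ℝ := τ - s₁ with hu
  obtain ⟨hu0, hu2⟩ : 0 ≤ u ∧ u ≤ 2 := ⟨by simp only [hu]; linarith, by simp only [hu]; linarith⟩
  have h12 : exp ((1 - θ) * M * u ^ 2 / 2 - 2 * η - M) ≤ 12 := by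
    have hpos : 0 < ε ^ 2 / (12 * K ^ 10) := by positivity
    have e : ε ^ 2 / K ^ 10 = ε ^ 2 / (12 * K ^ 10) * 12 := by field_simp
    rw [e] at hlow; exact le_of_mul_le_mul_left hlow hpos
  have hA3 : (1 - θ) * M * u ^ 2 / 2 - 2 * η - M ≤ 3 := by
    have h1 := Real.log_le_log (exp_pos _) h12; rw [Real.log_exp] at h1
    have h16 : Real.log 12 ≤ Real.log 16 := Real.log_le_log (by norm_num) (by norm_num)
    have h4 : Real.log 16 = 4 * Real.log 2 := by rw [show (16:ℝ) = 2 ^ 4 by norm_num, Real.log_pow]; norm_num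
    linarith [Real.log_two_lt_d9]
  -- `M u² ≤ 2M + 4η + 6 + θ M u²`; first `u² ≤ 41/20` crudely, then `u² ≤ 2 + y`
  have h1 : M * u ^ 2 ≤ 2 * M + 4 * η + 6 + θ * M * u ^ 2 := by linarith
  have hθM0 : 0 ≤ θ * M := by have := hM0.le; positivity
  have hu4 : u ^ 2 ≤ 4 := by rw [sq]; have := mul_le_mul hu2 hu2 hu0 zero_le_two; linarith
  have hc4 : θ * M * u ^ 2 ≤ θ * M * 4 := mul_le_mul_of_nonneg_left hu4 hθM0
  have hθM : θ * M ≤ 1 / 100 * M := mul_le_mul_of_nonneg_right hθ100 hM0.le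
  have hu41 : u ^ 2 ≤ 41 / 20 := by
    by_contra hgt
    have h2 : M * (41 / 20) < M * u ^ 2 := mul_lt_mul_of_pos_left (not_le.1 hgt) hM0
    linarith
  have hc41 : θ * M * u ^ 2 ≤ θ * M * (41 / 20) := mul_le_mul_of_nonneg_left hu41 hθM0
  obtain ⟨y, hy⟩ : ∃ y : ℝ, y = (4 * η + 6) / M + 41 / 20 * θ := ⟨_, rfl⟩
  have hy0 : 0 ≤ y := by rw [hy]; positivity
  have huy : u ^ 2 ≤ 2 + y := by
    have e : M * (2 + y) = 2 * M + 4 * η + 6 + θ * M * (41 / 20) := by rw [hy]; field_simp; ring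
    have : M * u ^ 2 ≤ M * (2 + y) := by rw [e]; linarith
    exact le_of_mul_le_mul_left this hM0
  have hup : u ≤ sqrt 2 + y / 2 := le_sqrt_two_add hy0 huy
  -- `y/2 + θ s₁ ≤ 12 log K/M + 15η`: `(4η+6)/M ≤ 8/M`, `(51/40)θ ≤ 22/K²⁰ + (459/40)η`, `22/K²⁰ ≤ 1/M`
  have hy2 : y / 2 + θ * s₁ ≤ 12 * Real.log K / M + 15 * η := by
    have ha : (4 * η + 6) / M ≤ 8 / M := div_le_div_of_nonneg_right (by linarith) hM0.le
    have hb : 22 / K ^ 20 ≤ 1 / M := by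
      rw [div_le_div_iff₀ (by positivity) hM0, hK20, one_mul]
      have h22 : (22:ℝ) ≤ K ^ 10 := by norm_num at hK10; linarith
      exact mul_le_mul h22 hMK hM0.le hK10p.le
    have hd : θ * s₁ ≤ θ * (1 / 4) := mul_le_mul_of_nonneg_left hs₁4 hθ0
    have he : (51:ℝ) / 40 * (17 / K ^ 20) ≤ 22 / K ^ 20 := by
      rw [← mul_div_assoc]; exact div_le_div_of_nonneg_right (by norm_num) (pow_pos hK0 20).le
    have he' : 51 / 40 * θ ≤ 22 / K ^ 20 + 459 / 40 * η := by rw [hθ]; linarith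
    have hdiv : (8:ℝ) / M / 2 + 1 / M ≤ 12 * Real.log K / M := by
      rw [show (8:ℝ) / M / 2 + 1 / M = 5 / M by ring]; exact div_le_div_of_nonneg_right (by linarith) hM0.le
    rw [hy]; linarith
  -- lower edge: `(τ + hh)² ≥ 2 - x`, `x = 24 log K/M + 27η ≤ 8/5`
  have hq : (max (-hh) 0) ^ 2 = hh ^ 2 := by rw [max_eq_left (by linarith)]; ring
  rw [hq] at hlo
  have hx1 : 24 * Real.log K / M ≤ 1 := by rw [div_le_one hM0]; linarith
  have hlow2 : sqrt 2 - (24 * Real.log K / M + 27 * η) / 2 ≤ τ + hh :=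
    sqrt_two_sub_le (by linarith) (by positivity) (by linarith) (by linarith)
  have e24 : 24 * Real.log K / M = 2 * (12 * Real.log K / M) := by ring
  have hsum : τ = u + s₁ := by simp only [hu]; ring
  have hθs : s₁ + hh = θ * s₁ := by linarith
  rw [abs_le]
  exact ⟨by linarith, by linarith⟩

end Delay

end HeadStart

open HeadStart in
/-- **THE GATE THEOREM FOR A CLOCK BEHIND, WITH THE SHARP CRITICAL TIME.** Under the hypotheses of
`HeadStart.firingPhase` (family `K ≥ 2·20⁴²·42! + 16`, `3000 log K ≤ M ≤ K¹⁰`, `0 < ε ≤ e^{-10M}/K¹⁰⁰`; any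
diagonal damping `0 ≤ Eᵢ(t) ≤ η ≤ 1/1000` on `[0,2]`; any datum with `a₀² + b₀² = 1`, `a₀ ≥ 0`,
`-ε/5 ≤ b₀ ≤ 2ε/5`, `c₀ = d₀ = ã₀ = 0`) and `b₀ ≤ 0`: a critical time with `|t_c - (√2 + |b₀|/ε)| ≤
12 log K/M + 15η` (a clock behind by `|h|ε` fires LATER by exactly `|h|`), with the (able) box on `[0, t_c]`
and the (beable) box on `[t_c + 888 log K/M + 1/√K, 2]` of `HeadStart.firingPhase`. HONEST FRAMING: a theorem
about a five-mode ODE; low prior, high value-of-information experiment on Tao's machine paradigm; NOT a claim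
that NS blows up. [cite: Tao2016AveragedNS, Theorem 5.3, §5.5] -/
theorem HeadStart.firingPhase_delay {K M ε η : ℝ} {E X : ℝ → Fin 5 → ℝ}
    (hX : ∀ t ∈ Icc (0:ℝ) 2, HasDerivAt X (delayCircuitWith K M ε (X t) - E t * X t) t)
    (hE : ∀ t ∈ Icc (0:ℝ) 2, ∀ i, 0 ≤ E t i ∧ E t i ≤ η)
    (h0 : X 0 0 ^ 2 + X 0 1 ^ 2 = 1 ∧ 0 ≤ X 0 0 ∧ -(1 / 5 * ε) ≤ X 0 1 ∧ X 0 1 ≤ 2 / 5 * ε ∧ X 0 2 = 0 ∧ X 0 3 = 0 ∧ X 0 4 = 0)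
    (hb0 : X 0 1 ≤ 0)
    (hK : 2 * 20 ^ 42 * (Nat.factorial 42 : ℝ) + 16 ≤ K) (hML : 3000 * Real.log K ≤ M)
    (hMK : M ≤ K ^ 10) (hε : 0 < ε) (hεle : ε ≤ exp (-(10 * M)) / K ^ 100) (hη : η ≤ 1 / 1000) :
    ∃ tc : ℝ, |tc - (Real.sqrt 2 - X 0 1 / ε)| ≤ 12 * Real.log K / M + 15 * η ∧
      (∀ t ∈ Icc 0 tc,
        |X t 0 - 1| ≤ 200 / K ^ 10 + 2 * η ∧ ∀ i : Fin 5, i ≠ 0 → |X t i| ≤ 200 / K ^ 10) ∧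
      (∀ t ∈ Icc (tc + 888 * Real.log K / M + 1 / Real.sqrt K) 2,
        |X t 4 - 1| ≤ 200 / K ^ 10 + 4 * η ∧ ∀ i : Fin 5, i ≠ 4 → |X t i| ≤ 200 / K ^ 10) := by
  obtain ⟨hK16, hM0, -, hlog2, hN4, -⟩ := family_params hK hML
  have hf : (1:ℝ) ≤ (Nat.factorial 42 : ℝ) := Nat.one_le_cast.2 (Nat.factorial_pos 42)
  obtain ⟨hK400, hK1, hη100⟩ : (400:ℝ) ≤ K ∧ 1 ≤ K ∧ η ≤ 1 / 100 := ⟨by linarith, by linarith, by linarith⟩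
  obtain ⟨hδ0, hon, hδle⟩ := family_params_damped hK hML
  have hML1250 : 1250 * Real.log K ≤ M := by linarith
  obtain ⟨hε1, -, hε100, hεexp⟩ := eps_facts hK16 hM0 hMK hε hεle
  have hεK : ε ^ 2 ≤ 1 / (12 * K ^ 20) := by
    have h1 : ε ^ 2 ≤ (1 / K ^ 100) ^ 2 := pow_le_pow_left₀ hε.le hε100 2
    have h2 : (1 / K ^ 100) ^ 2 = 1 / (K ^ 180 * K ^ 20) := by rw [div_pow, one_pow, ← pow_mul, ← pow_add]
    have h3 : 1 / (K ^ 180 * K ^ 20) ≤ 1 / (12 * K ^ 20) := by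
      apply one_div_le_one_div_of_le (by positivity)
      have h180 : (12:ℝ) ≤ K ^ 180 := le_trans (by linarith) (le_self_pow₀ hK1 (by norm_num))
      exact mul_le_mul_of_nonneg_right h180 (by positivity)
    linarith [h2 ▸ h1]
  obtain ⟨τ, ⟨hlo, -, hτ1, hτ33⟩, hcτeq, hwin⟩ := quietPhase hX hE h0 hε hε1 hM0 hMK hK16 hML1250 hεK hη
  have hcτ : ∀ t, 0 ≤ t → t ≤ τ → X t 2 ≤ ε ^ 2 / K ^ 10 := fun t h0t htτ => (hwin t ⟨h0t, htτ⟩).1.2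
  have hfit : τ + 888 * Real.log K / M + (sqrt K)⁻¹ ≤ 2 := window_fits hK400 hτ33 hδle
  have hiK : 0 < (sqrt K)⁻¹ := (invSqrt_facts hK16).1; have hτ2 : τ ≤ 2 := by linarith
  refine ⟨τ, tc_delay hX hE h0 hε hε1 hM0 hMK hK16 hML1250 hεK hη hb0 hτ1 hτ2 hcτ hcτeq hlo, ?_, ?_⟩
  · exact fun t ht => able_window hX hE h0 hε hε1 hM0.le hK16 hεK hε100 hτ2 hcτ ht
  · intro t ht
    have ht0 : t ∈ Icc (0:ℝ) 2 := by
      refine ⟨?_, ht.2⟩; have h1 := ht.1; rw [one_div] at h1; linarith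
    exact beable_of_sum_sq hX hE h0 hK16 ht0 (late_sum_sq hX hE h0 hε hε1 hM0 hMK hK16 hεK hε100
      hεexp hη100 hδ0 hon hN4 hτ1 hfit hcτ hcτeq ht)

open HeadStart in
/-- The gate theorem for a clock behind, EXPLICIT datum `(√(1 - b₀²), b₀, 0, 0, 0)`, `-ε/5 ≤ b₀ ≤ 0`: `|t_c -
(√2 - b₀/ε)| ≤ 12 log K/M + 15η`, then (able)/(beable) as in `HeadStart.firingPhase`. [cite: Tao2016AveragedNS, §5.5] -/
theorem HeadStart.firingPhase_delay_explicit {K M ε η b₀ : ℝ} {E X : ℝ → Fin 5 → ℝ}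
    (hX : ∀ t ∈ Icc (0:ℝ) 2, HasDerivAt X (delayCircuitWith K M ε (X t) - E t * X t) t)
    (hE : ∀ t ∈ Icc (0:ℝ) 2, ∀ i, 0 ≤ E t i ∧ E t i ≤ η)
    (hb0 : -(1 / 5 * ε) ≤ b₀) (hb : b₀ ≤ 0) (h0 : X 0 = ![sqrt (1 - b₀ ^ 2), b₀, 0, 0, 0])
    (hK : 2 * 20 ^ 42 * (Nat.factorial 42 : ℝ) + 16 ≤ K) (hML : 3000 * Real.log K ≤ M)
    (hMK : M ≤ K ^ 10) (hε : 0 < ε) (hεle : ε ≤ exp (-(10 * M)) / K ^ 100) (hη : η ≤ 1 / 1000) :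
    ∃ tc : ℝ, |tc - (Real.sqrt 2 - b₀ / ε)| ≤ 12 * Real.log K / M + 15 * η ∧
      (∀ t ∈ Icc 0 tc,
        |X t 0 - 1| ≤ 200 / K ^ 10 + 2 * η ∧ ∀ i : Fin 5, i ≠ 0 → |X t i| ≤ 200 / K ^ 10) ∧
      (∀ t ∈ Icc (tc + 888 * Real.log K / M + 1 / Real.sqrt K) 2,
        |X t 4 - 1| ≤ 200 / K ^ 10 + 4 * η ∧ ∀ i : Fin 5, i ≠ 4 → |X t i| ≤ 200 / K ^ 10) := by
  obtain ⟨hK16, hM0, -⟩ := family_params hK hML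
  have hε1 : ε ≤ 1 := (eps_facts hK16 hM0 hMK hε hεle).1
  have hb1 : X 0 1 = b₀ := by rw [h0]; rfl
  have h := HeadStart.firingPhase_delay hX hE (hs_of_explicit hε1 hb0 (hb.trans (by positivity)) h0)
    (by rw [hb1]; exact hb) hK hML hMK hε hεle hη
  rwa [hb1] at h

end Summit.NavierStokesRegularity.FluidComputer
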